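import Summits.AtomisticToContinuum.Crystallization.Theorems.FrustratedLawDichotomyCollarCensusUnion

/-!
# FrustratedLawDichotomy · cruxes `AperiodicFrustratedLawGap` / `PeriodicFrustratedLawGap` (stmt-AtomisticToContinuum-27623 / 27624) — the TIGHT
# COLLAR: a structural re-cut of the strained-patch piece (decomp-a2c, prover hand 2, generation 18; answer to lens-5 g42 «MEASURED 02:00Z»:
# `F1X` violated in float by a strained 9/5-ball whose ≈ 10 other bonds per member relax into a TIGHT (1/20-good) annulus — «the T-leaf needs a
# structural re-cut of the strained piece, not a dial»; critic row 641 (5) «socket = the generic-ExM apex»)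

THE RE-CUT.  In every collared node so far the credit column of the X-surplus refunds the sites near an EXEMPT site (`Collar r ExM`, count
`≤ Mball r·#ExM ≤ Mball r·#Ex`, booked against the cluster-level exempt count `D_T·#Ex`), while a capped-TIGHT (`1/20`-good at scale `D`) site is
credited only IN ITS OWN BALLS (`TightNearCap ρ`: tight member ⇒ absorbed).  But the cluster-level currency `Topt♭` has a SECOND refund slot,
`C_T·g` with `g = #GoodAt(1/20)` — and `C_T` is as free as `D_T` (`…ExemptSplit.exemptFDG_of_splitX` takes any `C_T`).  So the collar may carry the
tight sites too: with `P := ExM ∨ capped-tight`, `Σ_j 𝟙[Collar r P](j) ≤ Mball r·(#Ex + g)` (§1 `sum_flag_collar_le_split`), and a nonnegative X ball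
book at the exemption `Collar r P` gives `Topt♭(κ_T; C_T + Mball r·D_T, Mball r·D_T; Ex)` (§1 `schurTopologicalPricingX_of_ballAveragedCapX_collarT`).
Consequence for the pieces (§3–§4): a ball is priced only if NO site within `r = 9/2` of any member is exempt OR TIGHT — the strained-patch piece
`F1X∪T` now speaks about balls inside a tight-free, exempt-free region of radius `ρ + r = 63/10`, not about a strained island in a relaxed sea
(lens-5's mechanism: the misfit label survives on 39 members while their other bonds relax against 1/20-GOOD neighbours — those neighbours now absorb
the ball).  Zero cost at the door; every union certificate transfers (`collarPiecesKK_unionT_of_union`, antitone in the exemption).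

* §1 the split count and the bridge; §2 the apex with the two-slot transfer `P ⟹ Ex ∨ GoodAt(1/20)` (generic range data / levies / `P` / `Ex`);
* §3 the instance `P := ExM∪(S) ∨ GoodAtScale (1/20) D` (local: `flag_unionTight_isLocal`; transfer: `unionTight_transfer`), node
  `…_of_collarMotifCapKK_unionT` (+ periodic); §4 the leaf `…_of_collarPiecesKK_milli_unionT` (door-free, record literals; + periodic) and the transfer
  from the union pieces of record.  All `[folklore]`; 0 sorry; no definitions.
-/

noncomputable section

namespace Summit.AtomisticToContinuum.Crystallization.Theorems.FrustratedLawDichotomyCollarCensusTight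

open scoped BigOperators Classical
open Literature.MathematicalPhysics.StatisticalMechanics (interactionEnergy)
open Summit.AtomisticToContinuum.Crystallization.Theorems.ChargedEnergyGapNegative (E3 eStar)
open Summit.AtomisticToContinuum.Crystallization.Theorems.FrustratedLawDichotomyRangeCut
open Summit.AtomisticToContinuum.Crystallization.Theorems.FrustratedLawDichotomySchurCut
open Summit.AtomisticToContinuum.Crystallization.Theorems.FrustratedLawDichotomyMotifLemmas
open Summit.AtomisticToContinuum.Crystallization.Theorems.FrustratedLawDichotomyRuleToolkit (IsLocalFeature)
open Summit.AtomisticToContinuum.Crystallization.Theorems.FrustratedLawDichotomyRuleToolkitGood (goodAtScale_of_motif)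
open Summit.AtomisticToContinuum.Crystallization.Theorems.FrustratedLawDichotomyMotifDoorE (goodAtScale_restrict)
open Summit.AtomisticToContinuum.Crystallization.Theorems.FrustratedLawDichotomyLocalPricing (goodCount_eq_sum)
open Summit.AtomisticToContinuum.Crystallization.Theorems.FrustratedLawDichotomyAveragingCut
  (ball ballAvg mem_ball sum_ballAvg Mball one_le_Mball Dfl Dfl_pos CT₀ Dfl_le_CT₀ CT₄₅ W₄₅_cutBounds CutBounds)
open Summit.AtomisticToContinuum.Crystallization.Theorems.FrustratedLawDichotomyAveragingRule
open Summit.AtomisticToContinuum.Crystallization.Theorems.FrustratedLawDichotomyAveragingRuleCap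
open Summit.AtomisticToContinuum.Crystallization.Theorems.FrustratedLawDichotomyAveragingRuleTightFree (TightNearCap BadNearCap)
open Summit.AtomisticToContinuum.Crystallization.Theorems.FrustratedLawDichotomyExemptDoor (SitePred DeepAbsent)
open Summit.AtomisticToContinuum.Crystallization.Theorems.FrustratedLawDichotomyExemptLocOpt (LocOptFails deepAbsent_locOptFails)
open Summit.AtomisticToContinuum.Crystallization.Theorems.FrustratedLawDichotomyExemptSplit
  (SchurTopologicalPricingX SchurElasticPricingX aperiodicFrustratedLawGap_of_splitX periodicFrustratedLawGap_of_splitX)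
open Summit.AtomisticToContinuum.Crystallization.Theorems.FrustratedLawDichotomyBumpAutocorrelation (sf₄₅_holds)
open Summit.AtomisticToContinuum.Crystallization.Theorems.FrustratedLawDichotomyExemptAbsorption
open Summit.AtomisticToContinuum.Crystallization.Theorems.FrustratedLawDichotomyExemptAbsorptionRecord
open Summit.AtomisticToContinuum.Crystallization.Theorems.FrustratedLawDichotomyCollarCensus
open Summit.AtomisticToContinuum.Crystallization.Theorems.FrustratedLawDichotomyCollarCensusKappa
open Summit.AtomisticToContinuum.Crystallization.Theorems.FrustratedLawDichotomyCollarCensusUnion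
open Summit.AtomisticToContinuum.Crystallization.Theorems.GrainCoreNetworkSplitMuEquilibriumDoor (muEquilibriumDoor)

/-! ## §1. The collar count split over the two refund slots, and the bridge -/

/-- ★ **SPLIT COLLAR COUNT**: if the core predicate `P` implies «cluster-exempt OR `η₀`-good», then under the hard core
`Σ_j 𝟙[Collar r P](j) ≤ Mball r·(#{Ex} + g)`, `g = goodCount η₀` (`r ≥ 0`). [folklore] -/
theorem sum_flag_collar_le_split {r η₀ : ℝ} (hr : 0 ≤ r) {P Ex : SitePred} {N : ℕ} {y : Fin N → E3} (hs : Sep y)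
    (hImp : ∀ j : Fin N, P N y j → Ex N y j ∨ GoodAt η₀ y j) :
    ∑ j, flag (Collar r P) N y j ≤ Mball r * ((Nat.card {j : Fin N // Ex N y j} : ℝ) + goodCount η₀ y) := by
  have h1 := sum_flag_collar_le (P := P) hr hs
  have h2 : (Nat.card {j : Fin N // P N y j} : ℝ) ≤ Nat.card {j : Fin N // Ex N y j} + goodCount η₀ y := by
    rw [← sum_flag_eq_card P y, ← sum_flag_eq_card Ex y, goodCount_eq_sum, ← Finset.sum_add_distrib]
    refine Finset.sum_le_sum fun j _ => ?_
    unfold flag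
    by_cases hP : P N y j
    · rcases hImp j hP with hE | hG
      · simp only [if_pos hP, if_pos hE]; split_ifs <;> norm_num
      · simp only [if_pos hP, if_pos hG]; split_ifs <;> norm_num
    · simp only [if_neg hP]; split_ifs <;> norm_num
  exact h1.trans (mul_le_mul_of_nonneg_left h2 (zero_le_one.trans (one_le_Mball hr)))

/-- ★★ **THE BRIDGE WITH THE TIGHT COLLAR**: a nonnegative X ball book at the exemption `Collar r P`, where `P ⟹ Ex ∨ GoodAt η₀` pointwise on
injective `7/10`-separated clusters, gives `Topt♭`-type pricing with BOTH refund constants raised by the collar credit: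
`C_T ↦ C_T + Mball r·D_T`, `D_T ↦ Mball r·D_T` (`ρ, r ≥ 0`). [folklore] -/
theorem schurTopologicalPricingX_of_ballAveragedCapX_collarT {ρ r η₀ η₁ D A eUp κT CT DT : ℝ} {w ω : ℝ → ℝ} {P Ex : SitePred}
    (hρ : 0 ≤ ρ) (hr : 0 ≤ r) (hκ : 0 ≤ κT) (hC : 0 ≤ CT) (hDT : 0 ≤ DT)
    (hImp : ∀ (N : ℕ) (y : Fin N → E3), Function.Injective y → Sep y → ∀ j : Fin N, P N y j → Ex N y j ∨ GoodAt η₀ y j)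
    (h : BallAveragedPricingCapX ρ η₀ η₁ D (effPot w ω A) (eUp + A) κT CT DT (Collar r P)) :
    SchurTopologicalPricingX η₀ η₁ w ω A eUp κT (CT + Mball r * DT) (Mball r * DT) Ex := by
  intro N y hy hs
  have hsum : 0 ≤ ∑ i, ballAvg ρ y (surplusCapX η₀ η₁ D (effPot w ω A) (eUp + A) κT CT DT (Collar r P) N y) i :=
    Finset.sum_nonneg fun i _ => h N y hy hs i
  rw [sum_ballAvg hρ] at hsum
  have hK1 : ∑ j, flag (Collar r P) N y j ≤ 1 * (Nat.card {j : Fin N // Collar r P N y j} : ℝ) := by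
    rw [one_mul, sum_flag_eq_card]
  have hle := sum_surplusCapX_le_count (η₀ := η₀) (η₁ := η₁) (D := D) (W := effPot w ω A) (e := eUp + A) hκ hC hDT y hK1
  have hsplit : (Nat.card {j : Fin N // Collar r P N y j} : ℝ) ≤ Mball r * ((Nat.card {j : Fin N // Ex N y j} : ℝ) + goodCount η₀ y) := by
    rw [← sum_flag_eq_card]; exact sum_flag_collar_le_split hr hs (hImp N y hy hs)
  have h3 := mul_le_mul_of_nonneg_left hsplit hDT
  unfold interactionEnergy at hle ⊢
  linarith

/-- ★ **Census-object form** (`W` with `CutBounds W R B` vanishing beyond `R′ ≤ ρ₁ + r`; `P` with `ρ₁`-local flag; `0 ≤ κ_T ≤ 1`):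
`EquilibriumMotifPricingCapK κ_T ρ ϱ D W (eUp + A) (Collar r P) ⟹ Topt♭(κ_T; (1 + Mball r)·C_T⁰, Mball r·C_T⁰; Ex)` with `C_T⁰ = CT₀ R B (eUp + A) ρ`.
[folklore chaining] -/
theorem schurTopologicalPricingX_of_collarMotifCapKT {w ω : ℝ → ℝ} {A eUp R B R' ρ r ρ₁ ϱ D κT : ℝ} {P Ex : SitePred}
    (hWB : CutBounds (effPot w ω A) R B) (hW : ∀ t, R' ≤ t → effPot w ω A t = 0) (h0 : 0 ≤ ρ) (hr : 0 ≤ r) (h1 : 0 ≤ ρ₁) (hρ : ρ ≤ ρ₁ + r)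
    (hR : R' ≤ ρ₁ + r) (hD : 13 / 10 * D + 1 ≤ ρ₁ + r) (hϱ : ρ + (ρ₁ + r) ≤ ϱ) (hEx : IsLocalFeature ρ₁ (flag P)) (hκ0 : 0 ≤ κT) (hκ1 : κT ≤ 1)
    (hImp : ∀ (N : ℕ) (y : Fin N → E3), Function.Injective y → Sep y → ∀ j : Fin N, P N y j → Ex N y j ∨ GoodAt (1 / 20) y j)
    (h : EquilibriumMotifPricingCapK κT ρ ϱ D (effPot w ω A) (eUp + A) (Collar r P)) :
    SchurTopologicalPricingX (1 / 20) (1 / 8) w ω A eUp κT (CT₀ R B (eUp + A) ρ + Mball r * CT₀ R B (eUp + A) ρ)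
      (Mball r * CT₀ R B (eUp + A) ρ) Ex :=
  have hC : 0 ≤ CT₀ R B (eUp + A) ρ :=
    (Dfl_pos hWB.range_nonneg hWB.floor_nonneg).le.trans (Dfl_le_CT₀ hWB.range_nonneg hWB.floor_nonneg ρ)
  schurTopologicalPricingX_of_ballAveragedCapX_collarT h0 hr hκ0 hC hC hImp
    ((ballAveragedPricingCapX_iff_motif hW (by norm_num) (by norm_num) h0 hρ hR hD hϱ (flag_collar_isLocal h1 hEx)).2
      (ballAveragedMotifPricingCapX_of_equilibriumK hWB h0 hκ0 hκ1 le_rfl le_rfl h))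

/-! ## §2. The apex with the two-slot transfer -/

/-- ★★★ **THE COLLARED NODE WITH THE TIGHT COLLAR, GENERIC IN EVERYTHING** (range data `SchurFloor w ω A`, `CutBounds (effPot w ω A) R B`,
`effPot = 0` on `[R′, ∞)`, `UP(eUp)`; levies `0 < κ_T ≤ 1`, `0 < κ_E`; cluster exemption `Ex` deep-absent at depth `M` and shared with the E-side;
core predicate `P` with `ρ₁`-local flag and the TWO-SLOT transfer `P ⟹ Ex ∨ GoodAt(1/20)` on injective separated clusters; geometry as in
`…CollarCensusUnion.…_exM`): `MuEquilibriumDoor ∧ EquilibriumMotifPricingCapK κ_T ρ ϱ D W (eUp + A) (Collar r P) ⟹ AperiodicFrustratedLawGap`.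
[folklore chaining] -/
theorem aperiodicFrustratedLawGap_of_collarMotifCapKK_exMT {w ω : ℝ → ℝ} {A R B R' eUp κT κE ρ r ρ₁ ϱ D CE DE DX M : ℝ} {P Ex : SitePred}
    (hDoor : Summit.AtomisticToContinuum.Crystallization.Theses.GrainCoreNetworkSplit.MuEquilibriumDoor)
    (hF : SchurFloor w ω A) (hWB : CutBounds (effPot w ω A) R B) (hW : ∀ u, R' ≤ u → effPot w ω A u = 0)
    (hU : PeriodicEnergyCeiling eUp) (hEx : DeepAbsent M Ex) (hDX : 0 ≤ DX) (hκE : 0 < κE)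
    (hE : SchurElasticPricingX (1 / 20) (1 / 8) w ω A eUp κE CE DE DX Ex)
    (hκ0 : 0 < κT) (hκ1 : κT ≤ 1) (h0 : 0 ≤ ρ) (hr : 0 ≤ r) (h1 : 0 ≤ ρ₁) (hρ : ρ ≤ ρ₁ + r) (hR : R' ≤ ρ₁ + r)
    (hD : 13 / 10 * D + 1 ≤ ρ₁ + r) (hϱ : ρ + (ρ₁ + r) ≤ ϱ) (hP : IsLocalFeature ρ₁ (flag P))
    (hImp : ∀ (N : ℕ) (y : Fin N → E3), Function.Injective y → Sep y → ∀ j : Fin N, P N y j → Ex N y j ∨ GoodAt (1 / 20) y j)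
    (h : EquilibriumMotifPricingCapK κT ρ ϱ D (effPot w ω A) (eUp + A) (Collar r P)) :
    Summit.AtomisticToContinuum.Crystallization.Theses.FrustratedLawDichotomy.AperiodicFrustratedLawGap :=
  have hC : 0 ≤ CT₀ R B (eUp + A) ρ :=
    (Dfl_pos hWB.range_nonneg hWB.floor_nonneg).le.trans (Dfl_le_CT₀ hWB.range_nonneg hWB.floor_nonneg ρ)
  have hM : 0 ≤ Mball r * CT₀ R B (eUp + A) ρ := mul_nonneg (zero_le_one.trans (one_le_Mball hr)) hC
  aperiodicFrustratedLawGap_of_splitX hDoor (by norm_num) hF hU hEx hκ0 hM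
    (schurTopologicalPricingX_of_collarMotifCapKT hWB hW h0 hr h1 hρ hR hD hϱ hP hκ0.le hκ1 hImp h) hκE hDX hE

/-- ★★ **Periodic sibling (27624) of the tight-collar apex.** [folklore chaining] -/
theorem periodicFrustratedLawGap_of_collarMotifCapKK_exMT {w ω : ℝ → ℝ} {A R B R' eUp κT κE ρ r ρ₁ ϱ D CE DE DX M : ℝ} {P Ex : SitePred}
    (hDoor : Summit.AtomisticToContinuum.Crystallization.Theses.GrainCoreNetworkSplit.MuEquilibriumDoor)
    (hF : SchurFloor w ω A) (hWB : CutBounds (effPot w ω A) R B) (hW : ∀ u, R' ≤ u → effPot w ω A u = 0)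
    (hU : PeriodicEnergyCeiling eUp) (hEx : DeepAbsent M Ex) (hDX : 0 ≤ DX) (hκE : 0 < κE)
    (hE : SchurElasticPricingX (1 / 20) (1 / 8) w ω A eUp κE CE DE DX Ex)
    (hκ0 : 0 < κT) (hκ1 : κT ≤ 1) (h0 : 0 ≤ ρ) (hr : 0 ≤ r) (h1 : 0 ≤ ρ₁) (hρ : ρ ≤ ρ₁ + r) (hR : R' ≤ ρ₁ + r)
    (hD : 13 / 10 * D + 1 ≤ ρ₁ + r) (hϱ : ρ + (ρ₁ + r) ≤ ϱ) (hP : IsLocalFeature ρ₁ (flag P))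
    (hImp : ∀ (N : ℕ) (y : Fin N → E3), Function.Injective y → Sep y → ∀ j : Fin N, P N y j → Ex N y j ∨ GoodAt (1 / 20) y j)
    (h : EquilibriumMotifPricingCapK κT ρ ϱ D (effPot w ω A) (eUp + A) (Collar r P)) :
    Summit.AtomisticToContinuum.Crystallization.Theses.FrustratedLawDichotomy.PeriodicFrustratedLawGap :=
  have hC : 0 ≤ CT₀ R B (eUp + A) ρ :=
    (Dfl_pos hWB.range_nonneg hWB.floor_nonneg).le.trans (Dfl_le_CT₀ hWB.range_nonneg hWB.floor_nonneg ρ)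
  have hM : 0 ≤ Mball r * CT₀ R B (eUp + A) ρ := mul_nonneg (zero_le_one.trans (one_le_Mball hr)) hC
  periodicFrustratedLawGap_of_splitX hDoor (by norm_num) hF hU hEx hκ0 hM
    (schurTopologicalPricingX_of_collarMotifCapKT hWB hW h0 hr h1 hρ hR hD hϱ hP hκ0.le hκ1 hImp h) hκE hDX hE

/-! ## §3. The instance: union-over-steps exemption OR capped-tight, at the record range data -/

/-- ★ **The flag of `ExM∪(S) ∨ capped-tight` is `ρ₁`-local** (`Rm ≤ ρ₁`, `13/10·D + 1 ≤ ρ₁`). [folklore] -/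
theorem flag_unionTight_isLocal {eUp ε Rm t S D ρ₁ : ℝ} (hRm : Rm ≤ ρ₁) (hD : 13 / 10 * D + 1 ≤ ρ₁) :
    IsLocalFeature ρ₁ (flag fun N y j =>
      (∃ s : ℝ, 0 ≤ s ∧ s ≤ S ∧ NonEquilibriumCore eUp ε Rm s t N y j) ∨ GoodAtScale (1 / 20) D y j) :=
  isLocalFeature_flag_of_iff fun _ _ _ _ hφ _ hS =>
    or_congr (iff_of_isLocalFeature_flag (flag_nonEquilibriumCore_union_isLocal (eUp := eUp) (ε := ε) (t := t) (S := S) hRm) hφ hS)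
      ⟨goodAtScale_of_motif hS hD, goodAtScale_restrict hS hD (by norm_num)⟩

/-- ★ **Two-slot transfer of the instance**: on a `7/10`-separated cluster, `ExM∪(S) ⟹ ¬LocOpt e⋆ ε ϱ′ 1` (`e⋆ ≤ eUp`, `1 + S ≤ Rm`, `S ≤ ϱ′`, `ε ≤ t`)
and `GoodAtScale (1/20) D ⟹ GoodAt (1/20)` (drop the cap). [folklore chaining] -/
theorem unionTight_transfer {eUp ε Rm t S D ϱ' : ℝ} (hUp : eStar ≤ eUp) (hRm1 : 1 + S ≤ Rm) (hS : S ≤ ϱ') (hεt : ε ≤ t)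
    (N : ℕ) (y : Fin N → E3) (_hy : Function.Injective y) (hsep : Sep y) (j : Fin N)
    (h : (∃ s : ℝ, 0 ≤ s ∧ s ≤ S ∧ NonEquilibriumCore eUp ε Rm s t N y j) ∨ GoodAtScale (1 / 20) D y j) :
    LocOptFails eStar ε ϱ' 1 N y j ∨ GoodAt (1 / 20) y j :=
  h.imp (locOptFails_of_nonEquilibriumCore_union hUp hRm1 hS hεt hsep) GoodAtScale.goodAt

/-- The union exemption is contained in the union-or-tight core (pieces are antitone along this inclusion). [folklore] -/
theorem union_le_unionTight {eUp ε Rm t S D : ℝ} (N : ℕ) (y : Fin N → E3) (j : Fin N)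
    (h : ∃ s : ℝ, 0 ≤ s ∧ s ≤ S ∧ NonEquilibriumCore eUp ε Rm s t N y j) :
    (∃ s : ℝ, 0 ≤ s ∧ s ≤ S ∧ NonEquilibriumCore eUp ε Rm s t N y j) ∨ GoodAtScale (1 / 20) D y j :=
  Or.inl h

/-- ★★ **THE TIGHT-COLLAR NODE** at the record range data (`W₄₅`, `UP(−0.7175)`), both levies and the geometry as parameters
(`0 ≤ ρ ≤ ρ₁ + r`, `9/2 ≤ ρ₁ + r`, `13/10·D + 1 ≤ ρ₁`, `Rm ≤ ρ₁`, `ρ + (ρ₁ + r) ≤ ϱ`, `1 + S ≤ Rm`, `S ≤ ϱ′`, `0 < ε ≤ t`):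
`MuEquilibriumDoor ∧ UP ∧ Eopt-raw(κ_E; LocOptFails e⋆ ε ϱ′ 1) ∧ EquilibriumMotifPricingCapK κ_T ρ ϱ D W₄₅ e₄₅′ (Collar r (ExM∪(S) ∨ capped-tight)) ⟹ crux`.
[folklore chaining] -/
theorem aperiodicFrustratedLawGap_of_collarMotifCapKK_unionT {κT κE ρ r ρ₁ ϱ D ε Rm t S ϱ' CE DE DX : ℝ}
    (hDoor : Summit.AtomisticToContinuum.Crystallization.Theses.GrainCoreNetworkSplit.MuEquilibriumDoor)
    (hU : PeriodicEnergyCeiling (-(7175 / 10000))) (hε : 0 < ε) (hDX : 0 ≤ DX) (hκE : 0 < κE)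
    (hE : SchurElasticPricingX (1 / 20) (1 / 8) w₄₅ ω₄ (3 / 400) (-(7175 / 10000)) κE CE DE DX (LocOptFails eStar ε ϱ' 1))
    (hκ0 : 0 < κT) (hκ1 : κT ≤ 1) (h0 : 0 ≤ ρ) (hr : 0 ≤ r) (h1 : 0 ≤ ρ₁) (hρ : ρ ≤ ρ₁ + r) (hR : 9 / 2 ≤ ρ₁ + r)
    (hD : 13 / 10 * D + 1 ≤ ρ₁) (hRm : Rm ≤ ρ₁) (hϱ : ρ + (ρ₁ + r) ≤ ϱ) (hRm1 : 1 + S ≤ Rm) (hS : S ≤ ϱ') (hεt : ε ≤ t)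
    (h : EquilibriumMotifPricingCapK κT ρ ϱ D (effPot w₄₅ ω₄ (3 / 400)) (-(7175 / 10000) + 3 / 400)
      (Collar r fun N y j =>
        (∃ s : ℝ, 0 ≤ s ∧ s ≤ S ∧ NonEquilibriumCore (-(7175 / 10000)) ε Rm s t N y j) ∨ GoodAtScale (1 / 20) D y j)) :
    Summit.AtomisticToContinuum.Crystallization.Theses.FrustratedLawDichotomy.AperiodicFrustratedLawGap :=
  aperiodicFrustratedLawGap_of_collarMotifCapKK_exMT hDoor sf₄₅_holds W₄₅_cutBounds (fun _ hu => effPot_fourHalf_eq_zero _ hu) hU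
    (deepAbsent_locOptFails hε) hDX hκE hE hκ0 hκ1 h0 hr h1 hρ hR (hD.trans (le_add_of_nonneg_right hr)) hϱ (flag_unionTight_isLocal hRm hD)
    (unionTight_transfer (eStar_le_of_periodicEnergyCeiling hU) hRm1 hS hεt) h

/-- ★ **Periodic sibling (27624) of the tight-collar node.** [folklore chaining] -/
theorem periodicFrustratedLawGap_of_collarMotifCapKK_unionT {κT κE ρ r ρ₁ ϱ D ε Rm t S ϱ' CE DE DX : ℝ}
    (hDoor : Summit.AtomisticToContinuum.Crystallization.Theses.GrainCoreNetworkSplit.MuEquilibriumDoor)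
    (hU : PeriodicEnergyCeiling (-(7175 / 10000))) (hε : 0 < ε) (hDX : 0 ≤ DX) (hκE : 0 < κE)
    (hE : SchurElasticPricingX (1 / 20) (1 / 8) w₄₅ ω₄ (3 / 400) (-(7175 / 10000)) κE CE DE DX (LocOptFails eStar ε ϱ' 1))
    (hκ0 : 0 < κT) (hκ1 : κT ≤ 1) (h0 : 0 ≤ ρ) (hr : 0 ≤ r) (h1 : 0 ≤ ρ₁) (hρ : ρ ≤ ρ₁ + r) (hR : 9 / 2 ≤ ρ₁ + r)
    (hD : 13 / 10 * D + 1 ≤ ρ₁) (hRm : Rm ≤ ρ₁) (hϱ : ρ + (ρ₁ + r) ≤ ϱ) (hRm1 : 1 + S ≤ Rm) (hS : S ≤ ϱ') (hεt : ε ≤ t)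
    (h : EquilibriumMotifPricingCapK κT ρ ϱ D (effPot w₄₅ ω₄ (3 / 400)) (-(7175 / 10000) + 3 / 400)
      (Collar r fun N y j =>
        (∃ s : ℝ, 0 ≤ s ∧ s ≤ S ∧ NonEquilibriumCore (-(7175 / 10000)) ε Rm s t N y j) ∨ GoodAtScale (1 / 20) D y j)) :
    Summit.AtomisticToContinuum.Crystallization.Theses.FrustratedLawDichotomy.PeriodicFrustratedLawGap :=
  periodicFrustratedLawGap_of_collarMotifCapKK_exMT hDoor sf₄₅_holds W₄₅_cutBounds (fun _ hu => effPot_fourHalf_eq_zero _ hu) hU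
    (deepAbsent_locOptFails hε) hDX hκE hE hκ0 hκ1 h0 hr h1 hρ hR (hD.trans (le_add_of_nonneg_right hr)) hϱ (flag_unionTight_isLocal hRm hD)
    (unionTight_transfer (eStar_le_of_periodicEnergyCeiling hU) hRm1 hS hεt) h

/-! ## §4. The tight-collar leaf line at the literals of record, and the transfer from the union pieces -/

/-- ★★★ **THE TIGHT-COLLAR LEAF LINE** (door-free; levies `κ_T = 1/1000`, `κ_E = 1/10000`; record geometry `(ρ, D, r, ρ₁, ϱ, ε, Rm, t, S, ϱ′) =
(9/5, 3/2, 9/2, 7, 133/10, 10⁻⁴, 7, 10⁻⁴, 3/2, 3/2)`; exemption `ExM∪T = Collar (9/2) (ExM∪ ∨ GoodAtScale (1/20) (3/2))` — a ball is priced only if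
no site within `9/2` of a member is exempt OR TIGHT): `UP(−0.7175) ∧ 0 ≤ D_X ∧ Eopt-raw(1/10000) ∧ F1^X∪T ∧ CC∪T ∧ DD∪T ⟹ AperiodicFrustratedLawGap`.
[folklore instantiation] -/
theorem aperiodicFrustratedLawGap_of_collarPiecesKK_milli_unionT {CE DE DX : ℝ}
    (hU : PeriodicEnergyCeiling (-(7175 / 10000))) (hDX : 0 ≤ DX)
    (hE : SchurElasticPricingX (1 / 20) (1 / 8) w₄₅ ω₄ (3 / 400) (-(7175 / 10000)) (1 / 10000) CE DE DX
      (LocOptFails eStar (1 / 10000) (3 / 2) 1))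
    (h1 : StrainedPatchMotifPricingCapXK (1 / 1000) (9 / 5) (133 / 10) (3 / 2) (effPot w₄₅ ω₄ (3 / 400)) (-(7175 / 10000) + 3 / 400)
      (Collar (9 / 2) fun N y j => (∃ s : ℝ, 0 ≤ s ∧ s ≤ 3 / 2 ∧ NonEquilibriumCore (-(7175 / 10000)) (1 / 10000) 7 s (1 / 10000) N y j) ∨
        GoodAtScale (1 / 20) (3 / 2) y j))
    (h2 : CrowdedCoreMotifPricingCapK (1 / 1000) (9 / 5) (133 / 10) (3 / 2) (effPot w₄₅ ω₄ (3 / 400)) (-(7175 / 10000) + 3 / 400)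
      (Collar (9 / 2) fun N y j => (∃ s : ℝ, 0 ≤ s ∧ s ≤ 3 / 2 ∧ NonEquilibriumCore (-(7175 / 10000)) (1 / 10000) 7 s (1 / 10000) N y j) ∨
        GoodAtScale (1 / 20) (3 / 2) y j))
    (h3 : DiluteDefectMotifPricingCapK (1 / 1000) (9 / 5) (133 / 10) (3 / 2) (effPot w₄₅ ω₄ (3 / 400)) (-(7175 / 10000) + 3 / 400)
      (Collar (9 / 2) fun N y j => (∃ s : ℝ, 0 ≤ s ∧ s ≤ 3 / 2 ∧ NonEquilibriumCore (-(7175 / 10000)) (1 / 10000) 7 s (1 / 10000) N y j) ∨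
        GoodAtScale (1 / 20) (3 / 2) y j)) :
    Summit.AtomisticToContinuum.Crystallization.Theses.FrustratedLawDichotomy.AperiodicFrustratedLawGap :=
  aperiodicFrustratedLawGap_of_collarMotifCapKK_unionT (ρ₁ := 7) muEquilibriumDoor hU (by norm_num) hDX (by norm_num) hE (by norm_num)
    (by norm_num) (by norm_num) (by norm_num) (by norm_num) (by norm_num) (by norm_num) (by norm_num) le_rfl (by norm_num) (by norm_num) le_rfl
    le_rfl (equilibriumMotifPricingCapK_iff_pieces.2 ⟨h1, h2, h3⟩)

/-- ★★ **Periodic sibling (27624), tight-collar leaf line, door-free.** [folklore instantiation] -/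
theorem periodicFrustratedLawGap_of_collarPiecesKK_milli_unionT {CE DE DX : ℝ}
    (hU : PeriodicEnergyCeiling (-(7175 / 10000))) (hDX : 0 ≤ DX)
    (hE : SchurElasticPricingX (1 / 20) (1 / 8) w₄₅ ω₄ (3 / 400) (-(7175 / 10000)) (1 / 10000) CE DE DX
      (LocOptFails eStar (1 / 10000) (3 / 2) 1))
    (h1 : StrainedPatchMotifPricingCapXK (1 / 1000) (9 / 5) (133 / 10) (3 / 2) (effPot w₄₅ ω₄ (3 / 400)) (-(7175 / 10000) + 3 / 400)
      (Collar (9 / 2) fun N y j => (∃ s : ℝ, 0 ≤ s ∧ s ≤ 3 / 2 ∧ NonEquilibriumCore (-(7175 / 10000)) (1 / 10000) 7 s (1 / 10000) N y j) ∨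
        GoodAtScale (1 / 20) (3 / 2) y j))
    (h2 : CrowdedCoreMotifPricingCapK (1 / 1000) (9 / 5) (133 / 10) (3 / 2) (effPot w₄₅ ω₄ (3 / 400)) (-(7175 / 10000) + 3 / 400)
      (Collar (9 / 2) fun N y j => (∃ s : ℝ, 0 ≤ s ∧ s ≤ 3 / 2 ∧ NonEquilibriumCore (-(7175 / 10000)) (1 / 10000) 7 s (1 / 10000) N y j) ∨
        GoodAtScale (1 / 20) (3 / 2) y j))
    (h3 : DiluteDefectMotifPricingCapK (1 / 1000) (9 / 5) (133 / 10) (3 / 2) (effPot w₄₅ ω₄ (3 / 400)) (-(7175 / 10000) + 3 / 400)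
      (Collar (9 / 2) fun N y j => (∃ s : ℝ, 0 ≤ s ∧ s ≤ 3 / 2 ∧ NonEquilibriumCore (-(7175 / 10000)) (1 / 10000) 7 s (1 / 10000) N y j) ∨
        GoodAtScale (1 / 20) (3 / 2) y j)) :
    Summit.AtomisticToContinuum.Crystallization.Theses.FrustratedLawDichotomy.PeriodicFrustratedLawGap :=
  periodicFrustratedLawGap_of_collarMotifCapKK_unionT (ρ₁ := 7) muEquilibriumDoor hU (by norm_num) hDX (by norm_num) hE (by norm_num)
    (by norm_num) (by norm_num) (by norm_num) (by norm_num) (by norm_num) (by norm_num) (by norm_num) le_rfl (by norm_num) (by norm_num) le_rfl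
    le_rfl (equilibriumMotifPricingCapK_iff_pieces.2 ⟨h1, h2, h3⟩)

/-- ★★ **TRANSFER FROM THE UNION LINE OF RECORD**: the three pieces at the union exemption `Collar r ExM∪(S)` imply the three pieces at the
tight collar `Collar r (ExM∪(S) ∨ capped-tight)` (any levy, geometry, potential data) — every certificate for the line of record
`…CollarCensusUnion.…_milli_union_doorFree` feeds the tight-collar line. [folklore] -/
theorem collarPiecesKK_unionT_of_union {κT ρ ϱ D r eUp ε Rm t S D' : ℝ} {W : ℝ → ℝ} {e : ℝ}
    (h1 : StrainedPatchMotifPricingCapXK κT ρ ϱ D W e (Collar r fun N y j => ∃ s : ℝ, 0 ≤ s ∧ s ≤ S ∧ NonEquilibriumCore eUp ε Rm s t N y j))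
    (h2 : CrowdedCoreMotifPricingCapK κT ρ ϱ D W e (Collar r fun N y j => ∃ s : ℝ, 0 ≤ s ∧ s ≤ S ∧ NonEquilibriumCore eUp ε Rm s t N y j))
    (h3 : DiluteDefectMotifPricingCapK κT ρ ϱ D W e (Collar r fun N y j => ∃ s : ℝ, 0 ≤ s ∧ s ≤ S ∧ NonEquilibriumCore eUp ε Rm s t N y j)) :
    StrainedPatchMotifPricingCapXK κT ρ ϱ D W e
        (Collar r fun N y j => (∃ s : ℝ, 0 ≤ s ∧ s ≤ S ∧ NonEquilibriumCore eUp ε Rm s t N y j) ∨ GoodAtScale (1 / 20) D' y j) ∧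
      CrowdedCoreMotifPricingCapK κT ρ ϱ D W e
        (Collar r fun N y j => (∃ s : ℝ, 0 ≤ s ∧ s ≤ S ∧ NonEquilibriumCore eUp ε Rm s t N y j) ∨ GoodAtScale (1 / 20) D' y j) ∧
      DiluteDefectMotifPricingCapK κT ρ ϱ D W e
        (Collar r fun N y j => (∃ s : ℝ, 0 ≤ s ∧ s ≤ S ∧ NonEquilibriumCore eUp ε Rm s t N y j) ∨ GoodAtScale (1 / 20) D' y j) :=
  have himp := fun N y j => Collar.mono (union_le_unionTight (eUp := eUp) (ε := ε) (Rm := Rm) (t := t) (S := S) (D := D')) (N := N) (y := y)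
    (j := j)
  ⟨strainedPatchMotifPricingCapXK_anti_exM himp h1, crowdedCoreMotifPricingCapK_anti_exM himp h2, diluteDefectMotifPricingCapK_anti_exM himp h3⟩

/-! ## §5. The tight-collar leaf with the tolerance `ε ∈ (0, 10⁻⁴]` as a parameter (appended, hand 2 g18; critic row 643: the line of
record is the ε-FAMILY — here its tight-collar member, so that «ε-family × tight collar» is one theorem by name) -/

/-- ★★★ **THE TIGHT-COLLAR LEAF LINE, TOLERANCE AS A PARAMETER** (door-free; `0 < ε ≤ 10⁻⁴`, same `ε` in the exemption and in the E-side
`LocOptFails e⋆ ε (3/2) 1`; `t = 10⁻⁴` kept; record levies and geometry; exemption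
`ExM∪T(ε) = Collar (9/2) ((∃ s ∈ [0, 3/2], NonEquilibriumCore (−0.7175) ε 7 s 10⁻⁴) ∨ GoodAtScale (1/20) (3/2))`):
`UP(−0.7175) ∧ 0 ≤ D_X ∧ Eopt-raw(1/10000; ε) ∧ F1X∪T(ε) ∧ CC∪T(ε) ∧ DD∪T(ε) ⟹ AperiodicFrustratedLawGap`. [folklore instantiation] -/
theorem aperiodicFrustratedLawGap_of_collarPiecesKK_milli_unionT_eps {ε CE DE DX : ℝ} (hε0 : 0 < ε) (hε1 : ε ≤ 1 / 10000)
    (hU : PeriodicEnergyCeiling (-(7175 / 10000))) (hDX : 0 ≤ DX)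
    (hE : SchurElasticPricingX (1 / 20) (1 / 8) w₄₅ ω₄ (3 / 400) (-(7175 / 10000)) (1 / 10000) CE DE DX (LocOptFails eStar ε (3 / 2) 1))
    (h1 : StrainedPatchMotifPricingCapXK (1 / 1000) (9 / 5) (133 / 10) (3 / 2) (effPot w₄₅ ω₄ (3 / 400)) (-(7175 / 10000) + 3 / 400)
      (Collar (9 / 2) fun N y j => (∃ s : ℝ, 0 ≤ s ∧ s ≤ 3 / 2 ∧ NonEquilibriumCore (-(7175 / 10000)) ε 7 s (1 / 10000) N y j) ∨
        GoodAtScale (1 / 20) (3 / 2) y j))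
    (h2 : CrowdedCoreMotifPricingCapK (1 / 1000) (9 / 5) (133 / 10) (3 / 2) (effPot w₄₅ ω₄ (3 / 400)) (-(7175 / 10000) + 3 / 400)
      (Collar (9 / 2) fun N y j => (∃ s : ℝ, 0 ≤ s ∧ s ≤ 3 / 2 ∧ NonEquilibriumCore (-(7175 / 10000)) ε 7 s (1 / 10000) N y j) ∨
        GoodAtScale (1 / 20) (3 / 2) y j))
    (h3 : DiluteDefectMotifPricingCapK (1 / 1000) (9 / 5) (133 / 10) (3 / 2) (effPot w₄₅ ω₄ (3 / 400)) (-(7175 / 10000) + 3 / 400)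
      (Collar (9 / 2) fun N y j => (∃ s : ℝ, 0 ≤ s ∧ s ≤ 3 / 2 ∧ NonEquilibriumCore (-(7175 / 10000)) ε 7 s (1 / 10000) N y j) ∨
        GoodAtScale (1 / 20) (3 / 2) y j)) :
    Summit.AtomisticToContinuum.Crystallization.Theses.FrustratedLawDichotomy.AperiodicFrustratedLawGap :=
  aperiodicFrustratedLawGap_of_collarMotifCapKK_unionT (ρ₁ := 7) muEquilibriumDoor hU hε0 hDX (by norm_num) hE (by norm_num) (by norm_num)
    (by norm_num) (by norm_num) (by norm_num) (by norm_num) (by norm_num) (by norm_num) le_rfl (by norm_num) (by norm_num) le_rfl hε1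
    (equilibriumMotifPricingCapK_iff_pieces.2 ⟨h1, h2, h3⟩)

/-- ★★ **Periodic sibling (27624), tight collar, tolerance as a parameter, door-free.** [folklore instantiation] -/
theorem periodicFrustratedLawGap_of_collarPiecesKK_milli_unionT_eps {ε CE DE DX : ℝ} (hε0 : 0 < ε) (hε1 : ε ≤ 1 / 10000)
    (hU : PeriodicEnergyCeiling (-(7175 / 10000))) (hDX : 0 ≤ DX)
    (hE : SchurElasticPricingX (1 / 20) (1 / 8) w₄₅ ω₄ (3 / 400) (-(7175 / 10000)) (1 / 10000) CE DE DX (LocOptFails eStar ε (3 / 2) 1))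
    (h1 : StrainedPatchMotifPricingCapXK (1 / 1000) (9 / 5) (133 / 10) (3 / 2) (effPot w₄₅ ω₄ (3 / 400)) (-(7175 / 10000) + 3 / 400)
      (Collar (9 / 2) fun N y j => (∃ s : ℝ, 0 ≤ s ∧ s ≤ 3 / 2 ∧ NonEquilibriumCore (-(7175 / 10000)) ε 7 s (1 / 10000) N y j) ∨
        GoodAtScale (1 / 20) (3 / 2) y j))
    (h2 : CrowdedCoreMotifPricingCapK (1 / 1000) (9 / 5) (133 / 10) (3 / 2) (effPot w₄₅ ω₄ (3 / 400)) (-(7175 / 10000) + 3 / 400)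
      (Collar (9 / 2) fun N y j => (∃ s : ℝ, 0 ≤ s ∧ s ≤ 3 / 2 ∧ NonEquilibriumCore (-(7175 / 10000)) ε 7 s (1 / 10000) N y j) ∨
        GoodAtScale (1 / 20) (3 / 2) y j))
    (h3 : DiluteDefectMotifPricingCapK (1 / 1000) (9 / 5) (133 / 10) (3 / 2) (effPot w₄₅ ω₄ (3 / 400)) (-(7175 / 10000) + 3 / 400)
      (Collar (9 / 2) fun N y j => (∃ s : ℝ, 0 ≤ s ∧ s ≤ 3 / 2 ∧ NonEquilibriumCore (-(7175 / 10000)) ε 7 s (1 / 10000) N y j) ∨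
        GoodAtScale (1 / 20) (3 / 2) y j)) :
    Summit.AtomisticToContinuum.Crystallization.Theses.FrustratedLawDichotomy.PeriodicFrustratedLawGap :=
  periodicFrustratedLawGap_of_collarMotifCapKK_unionT (ρ₁ := 7) muEquilibriumDoor hU hε0 hDX (by norm_num) hE (by norm_num) (by norm_num)
    (by norm_num) (by norm_num) (by norm_num) (by norm_num) (by norm_num) (by norm_num) le_rfl (by norm_num) (by norm_num) le_rfl hε1
    (equilibriumMotifPricingCapK_iff_pieces.2 ⟨h1, h2, h3⟩)

/-- Sanity: at `ε = 10⁻⁴` the parametric tight-collar leaf IS `aperiodicFrustratedLawGap_of_collarPiecesKK_milli_unionT` (§4) (an `example`, dedup).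
[folklore] -/
example {CE DE DX : ℝ} (hU : PeriodicEnergyCeiling (-(7175 / 10000))) (hDX : 0 ≤ DX)
    (hE : SchurElasticPricingX (1 / 20) (1 / 8) w₄₅ ω₄ (3 / 400) (-(7175 / 10000)) (1 / 10000) CE DE DX
      (LocOptFails eStar (1 / 10000) (3 / 2) 1))
    (h1 : StrainedPatchMotifPricingCapXK (1 / 1000) (9 / 5) (133 / 10) (3 / 2) (effPot w₄₅ ω₄ (3 / 400)) (-(7175 / 10000) + 3 / 400)
      (Collar (9 / 2) fun N y j => (∃ s : ℝ, 0 ≤ s ∧ s ≤ 3 / 2 ∧ NonEquilibriumCore (-(7175 / 10000)) (1 / 10000) 7 s (1 / 10000) N y j) ∨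
        GoodAtScale (1 / 20) (3 / 2) y j))
    (h2 : CrowdedCoreMotifPricingCapK (1 / 1000) (9 / 5) (133 / 10) (3 / 2) (effPot w₄₅ ω₄ (3 / 400)) (-(7175 / 10000) + 3 / 400)
      (Collar (9 / 2) fun N y j => (∃ s : ℝ, 0 ≤ s ∧ s ≤ 3 / 2 ∧ NonEquilibriumCore (-(7175 / 10000)) (1 / 10000) 7 s (1 / 10000) N y j) ∨
        GoodAtScale (1 / 20) (3 / 2) y j))
    (h3 : DiluteDefectMotifPricingCapK (1 / 1000) (9 / 5) (133 / 10) (3 / 2) (effPot w₄₅ ω₄ (3 / 400)) (-(7175 / 10000) + 3 / 400)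
      (Collar (9 / 2) fun N y j => (∃ s : ℝ, 0 ≤ s ∧ s ≤ 3 / 2 ∧ NonEquilibriumCore (-(7175 / 10000)) (1 / 10000) 7 s (1 / 10000) N y j) ∨
        GoodAtScale (1 / 20) (3 / 2) y j)) :
    Summit.AtomisticToContinuum.Crystallization.Theses.FrustratedLawDichotomy.AperiodicFrustratedLawGap :=
  aperiodicFrustratedLawGap_of_collarPiecesKK_milli_unionT_eps (by norm_num) le_rfl hU hDX hE h1 h2 h3

end Summit.AtomisticToContinuum.Crystallization.Theorems.FrustratedLawDichotomyCollarCensusTight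

end
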